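import Mathlib

/-!
# GaugeDescent, support item `TorusOrbitDescent` (stmt-ValiantsHypothesis-6635) — the lattice
# section and the point with prescribed torus invariants

Route `GaugeDescent` of `ValiantsHypothesis`, support item `TorusOrbitDescent`. The "Hilbert 90 for
split tori is free" step of the descent: the lattice `Λ = {u ∈ ℤ^ι : A u = 0}` of invariant Laurent
monomials is saturated, hence a direct
summand: its Smith normal form has unit elementary divisors, giving a basis `e_i` and a linear
retraction `π` (`exists_retraction_of_saturated`); therefore,
for a point `x` with nonzero coordinates whose invariants `x^u` (`u ∈ Λ`) lie in a subfield `K`, the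
point `y_v := x^{E π(δ_v)}` has all coordinates in `K` and the same invariants
(`exists_point_with_invariants`) — so, by `GaugeDescentTorusImage.exists_torus_preimage`, lies in the
same torus orbit over any algebraically closed field. Honest framing: bookkeeping inside a dormant
route whose crux is open; nothing here bears on VP ≠ VNP.
-/

-- the summit and the problem share the name `ValiantsHypothesis` (D-0017 single-conjunct layout)
set_option linter.dupNamespace false

namespace Summit.ValiantsHypothesis.ValiantsHypothesis.Theorems.GaugeDescent

/-- **A saturated sublattice of `ℤ^ι` has a basis with a linear retraction.** -/
theorem exists_retraction_of_saturated {ι : Type*} [Fintype ι] (Λ : Submodule ℤ (ι → ℤ))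
    (hsat : ∀ (n : ℤ) (u : ι → ℤ), n ≠ 0 → n • u ∈ Λ → u ∈ Λ) :
    ∃ (r : ℕ) (e : Fin r → (ι → ℤ)) (π : (ι → ℤ) →ₗ[ℤ] (Fin r → ℤ)),
      (∀ i, e i ∈ Λ) ∧ ∀ u ∈ Λ, ∑ i, π u i • e i = u := by
  classical
  -- Smith normal form of `Λ ≤ ℤ^ι`; saturation forces the elementary divisors to be units
  obtain ⟨r, snf⟩ := Submodule.smithNormalForm (Pi.basisFun ℤ ι) Λ
  have ha0 : ∀ i, snf.a i ≠ 0 := by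
    intro i h0
    have h := snf.snf i
    rw [h0, zero_smul] at h
    exact snf.bN.ne_zero i (Subtype.ext h)
  have hmem : ∀ i, snf.bM (snf.f i) ∈ Λ := fun i =>
    hsat (snf.a i) _ (ha0 i) (by rw [← snf.snf i]; exact (snf.bN i).2)
  have ha1 : ∀ i, snf.a i * snf.a i = 1 := by
    intro i
    have h := snf.repr_apply_embedding_eq_repr_smul ⟨_, hmem i⟩ (i := i)
    rw [snf.bM.repr_self, Finsupp.single_eq_same, map_smul, Finsupp.smul_apply, smul_eq_mul] at h
    have hu : IsUnit (snf.a i) := IsUnit.of_mul_eq_one _ h.symm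
    rcases Int.isUnit_iff.mp hu with h1 | h1 <;> simp [h1]
  refine ⟨r, fun i => (snf.bN i : ι → ℤ),
    LinearMap.pi fun i => snf.a i • snf.bM.coord (snf.f i), fun i => (snf.bN i).2, fun u hu => ?_⟩
  simp only [LinearMap.pi_apply, LinearMap.smul_apply, Module.Basis.coord_apply, smul_eq_mul]
  -- `∑_i (a_i · repr u (f i)) • (a_i • bM (f i)) = ∑_i repr u (f i) • bM (f i) = u`
  have h1 : ∀ i, (snf.a i * snf.bM.repr u (snf.f i)) • (snf.bN i : ι → ℤ) =
      snf.bM.repr u (snf.f i) • snf.bM (snf.f i) := by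
    intro i
    rw [snf.snf i, smul_smul, mul_right_comm, ha1, one_mul]
  simp_rw [h1]
  -- the coordinates of `u ∈ Λ` outside `range f` vanish
  have h2 : ∑ i, snf.bM.repr u (snf.f i) • snf.bM (snf.f i) =
      ∑ j ∈ Finset.univ.map snf.f, snf.bM.repr u j • snf.bM j := by
    rw [Finset.sum_map]
  rw [h2, Finset.sum_subset (Finset.subset_univ _)]
  · exact snf.bM.sum_repr u
  · intro j _ hj
    have hj' : j ∉ Set.range snf.f := by
      rintro ⟨i, rfl⟩
      exact hj (Finset.mem_map_of_mem _ (Finset.mem_univ i))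
    rw [snf.repr_eq_zero_of_notMem_range ⟨u, hu⟩ hj', zero_smul]

/-- **A point with prescribed torus invariants over a subfield.** If `x ∈ L^ι` has nonzero
coordinates and all its Laurent monomials `∏_v x_v^{u_v}` with `A u = 0` lie in the subfield `K`,
then some `y ∈ K^ι` with nonzero coordinates has the same such monomials. -/
theorem exists_point_with_invariants {L : Type*} [Field L] (K : Subfield L) {ι κ : Type*}
    [Fintype ι] [DecidableEq ι] [Fintype κ] (A : κ → ι → ℤ) (x : ι → L) (hx : ∀ v, x v ≠ 0)
    (hK : ∀ u : ι → ℤ, (∀ l, ∑ v, A l v * u v = 0) → (∏ v, x v ^ u v) ∈ K) :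
    ∃ y : ι → L, (∀ v, y v ∈ K) ∧ (∀ v, y v ≠ 0) ∧
      ∀ u : ι → ℤ, (∀ l, ∑ v, A l v * u v = 0) → (∏ v, y v ^ u v) = ∏ v, x v ^ u v := by
  classical
  -- the lattice of invariant exponents and its retraction
  set ψ : (ι → ℤ) →ₗ[ℤ] (κ → ℤ) := Matrix.mulVecLin (Matrix.of A) with hψ
  have hψapply : ∀ (u : ι → ℤ) (l : κ), ψ u l = ∑ v, A l v * u v := fun u l => rfl
  have hmemker : ∀ u : ι → ℤ, u ∈ LinearMap.ker ψ ↔ ∀ l, ∑ v, A l v * u v = 0 := by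
    intro u
    rw [LinearMap.mem_ker]
    constructor
    · intro h l; rw [← hψapply, h]; rfl
    · intro h; ext l; rw [hψapply, h]; rfl
  have hsat : ∀ (n : ℤ) (u : ι → ℤ), n ≠ 0 → n • u ∈ LinearMap.ker ψ → u ∈ LinearMap.ker ψ := by
    intro n u hn hu
    rw [LinearMap.mem_ker, map_smul] at hu
    rw [LinearMap.mem_ker]
    exact (smul_eq_zero.mp hu).resolve_left hn
  obtain ⟨r, e, π, he, hπ⟩ := exists_retraction_of_saturated (LinearMap.ker ψ) hsat
  -- the character `u ↦ x^u`, additively, on units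
  set x' : ι → Lˣ := fun v => Units.mk0 (x v) (hx v) with hx'
  set χ₀ : (ι → ℤ) →+ Additive Lˣ :=
    { toFun := fun u => Additive.ofMul (∏ v, x' v ^ u v)
      map_zero' := by simp
      map_add' := fun u u' => by
        rw [← ofMul_mul, ← Finset.prod_mul_distrib]
        congr 1
        exact Finset.prod_congr rfl fun v _ => by rw [Pi.add_apply, zpow_add] } with hχ₀
  set χ : (ι → ℤ) →ₗ[ℤ] Additive Lˣ := χ₀.toIntLinearMap with hχ
  have hχapply : ∀ u, χ u = Additive.ofMul (∏ v, x' v ^ u v) := fun u => rfl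
  have hχval : ∀ u, ((Additive.toMul (χ u) : Lˣ) : L) = ∏ v, x v ^ u v := by
    intro u
    rw [hχapply, toMul_ofMul, Units.coe_prod]
    exact Finset.prod_congr rfl fun v _ => by rw [Units.val_zpow_eq_zpow_val, hx', Units.val_mk0]
  -- `Y = χ ∘ E ∘ π` agrees with `χ` on the lattice
  set E : (Fin r → ℤ) →ₗ[ℤ] (ι → ℤ) := Fintype.linearCombination ℤ e with hE
  set Y : (ι → ℤ) →ₗ[ℤ] Additive Lˣ := χ ∘ₗ E ∘ₗ π with hY
  have hEπmem : ∀ w : ι → ℤ, E (π w) ∈ LinearMap.ker ψ := by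
    intro w
    rw [hE, Fintype.linearCombination_apply]
    exact Submodule.sum_mem _ fun i _ => Submodule.smul_mem _ _ (he i)
  have hYχ : ∀ u ∈ LinearMap.ker ψ, Y u = χ u := by
    intro u hu
    rw [hY, LinearMap.comp_apply, LinearMap.comp_apply, hE, Fintype.linearCombination_apply, hπ u hu]
  -- the point
  refine ⟨fun v => ((Additive.toMul (Y (Pi.single v 1)) : Lˣ) : L), fun v => ?_, fun v => ?_,
    fun u hu => ?_⟩
  · -- membership in `K`: `y_v = x^{E π(δ_v)}` with `E π(δ_v) ∈ Λ`
    show ((Additive.toMul ((χ ∘ₗ E ∘ₗ π) (Pi.single v 1)) : Lˣ) : L) ∈ K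
    rw [LinearMap.comp_apply, LinearMap.comp_apply, hχval]
    exact hK _ ((hmemker _).mp (hEπmem _))
  · exact Units.ne_zero _
  · -- invariants
    have hu' : u ∈ LinearMap.ker ψ := (hmemker u).mpr hu
    have hsum : ∑ v, u v • (Pi.single v (1 : ℤ) : ι → ℤ) = u := by
      conv_rhs => rw [← Finset.univ_sum_single u]
      refine Finset.sum_congr rfl fun v _ => ?_
      ext w
      by_cases h : v = w
      · subst h; simp
      · simp [Pi.single_eq_of_ne' h]
    have hYu : ∑ v, u v • Y (Pi.single v 1) = Y u := by
      conv_rhs => rw [← hsum]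
      rw [map_sum]
      exact Finset.sum_congr rfl fun v _ => by rw [map_smul]
    calc (∏ v, (((Additive.toMul (Y (Pi.single v 1)) : Lˣ) : L)) ^ u v)
        = ((Additive.toMul (∑ v, u v • Y (Pi.single v 1)) : Lˣ) : L) := by
          rw [toMul_sum, Units.coe_prod]
          exact Finset.prod_congr rfl fun v _ => by rw [toMul_zsmul, Units.val_zpow_eq_zpow_val]
      _ = ((Additive.toMul (Y u) : Lˣ) : L) := by rw [hYu]
      _ = ∏ v, x v ^ u v := by rw [hYχ u hu', hχval]

end Summit.ValiantsHypothesis.ValiantsHypothesis.Theorems.GaugeDescent
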